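import Literature.Analysis.Matrix.LocalisedResponse
import HarnessLib

/-!
# Localised response, V: the MIXED ROW `u + P·mₛ + A·mₛₜ = 0` by differentiating the first-order response row along the second parameter

Topic `Literature/Analysis/Matrix`; namespace `Literature.Analysis.Matrix`.  Sequel of `LocalisedResponse.lean` (§2: the chain-rule door
`response_row_of_hasDerivAt` ∕ `response_row_matrix_of_hasDerivAt` producing the FIRST-order row `w + A·m′ = 0` from a branch of critical
points, and §4 `abs_mixedResponse_le` CONSUMING the mixed row) and companion of `LocalisedMixedResponse.lean` (the card-free two-profile bound
from the mixed row).  Everything here is PROVED; no definitions, no named facts.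

THE POINT.  Along a two-parameter branch of critical points `U(σ,τ)` the first-order row holds at every `τ`:
`w(τ) + A(τ)·m(τ) = 0` with `w(τ) = ∂_σG(σ,τ,U(σ,τ))`, `A(τ)` the Hessian at `U(σ,τ)`, `m(τ) = ∂_σU(σ,τ)`.  Differentiating this identity in
`τ` gives the MIXED ROW `w′ + A′·m + A·m′ = 0` — the hypothesis `hrow` of `abs_mixedResponse_le` ∕ `abs_mixedResponse_le_twoProfile` with
`u := w′` (the explicit mixed source), `P := A′` (the variation of the Hessian along the second move), `mₛ := m`, `mₛₜ := m′ = ∂_τ∂_σU`.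
* `hasDerivAt_mulVec_apply` — product rule for `τ ↦ (A τ *ᵥ m τ) k` from entrywise derivatives of `A` and coordinatewise derivatives of `m`.
* ★`mixed_row_of_hasDerivAt` — if `w τ + A τ *ᵥ m τ = 0` for all `τ` near `τ₀` and `w, A, m` are differentiable at `τ₀` (coordinate ∕ entrywise,
  derivatives `w′, A′, m′`), then `w′ + A′ *ᵥ m τ₀ + A τ₀ *ᵥ m′ = 0`.

Consumer: cell `ym3-torus`, crux `FluctuationComparisonRegPrIntL`, DISCHARGE-SPEC §11 (xv) (the `bστ` row of the one-loop capstone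
`trace_l1_hs_fourPt_inv_mul_le_of_response`, via `abs_mixedResponse_le_twoProfile`).  HONEST SCOPE: one product rule; the existence and
differentiability of the branch (implicit function theorem for the specific action) are NOT provided here.  Nothing here bears on the Yang–Mills
mass gap (Clay), which is NOT proved.

References: W. Rudin, *Principles of Mathematical Analysis* (1976) Thm 9.28, Thm 5.3 (product rule) [Rudin1976]; T. Bałaban, CMP 102 (1985) 277,
Thm 1 (10) p. 279 [Balaban1985Variational].
-/

noncomputable section

open Matrix Finset Filter
open scoped Matrix Topology

namespace Literature.Analysis.Matrix

variable {n : Type*} [Fintype n] [DecidableEq n]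

omit [DecidableEq n] in
/-- **Product rule for a matrix–vector product along a parameter**: if every entry `τ ↦ A τ k l` has derivative `A′ k l` at `τ₀` and every
coordinate `τ ↦ m τ l` has derivative `m′ l` at `τ₀`, then `τ ↦ (A τ *ᵥ m τ) k` has derivative `(A′ *ᵥ m τ₀) k + (A τ₀ *ᵥ m′) k` at `τ₀`.
[cite: Rudin1976, Thm 5.3 (product rule)] -/
theorem hasDerivAt_mulVec_apply {A : ℝ → Matrix n n ℝ} {A' : Matrix n n ℝ} {m : ℝ → n → ℝ} {m' : n → ℝ} {τ₀ : ℝ}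
    (hA : ∀ k l, HasDerivAt (fun τ => A τ k l) (A' k l) τ₀) (hm : ∀ l, HasDerivAt (fun τ => m τ l) (m' l) τ₀) (k : n) :
    HasDerivAt (fun τ => (A τ *ᵥ m τ) k) ((A' *ᵥ m τ₀) k + (A τ₀ *ᵥ m') k) τ₀ := by
  have h0 := HasDerivAt.sum (u := (univ : Finset n)) (fun l (_ : l ∈ (univ : Finset n)) => (hA k l).mul (hm l))
  have h1 : HasDerivAt (fun τ => (A τ *ᵥ m τ) k) (∑ l ∈ univ, (A' k l * m τ₀ l + A τ₀ k l * m' l)) τ₀ := by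
    refine h0.congr_of_eventuallyEq (Eventually.of_forall fun τ => ?_)
    simp only [Matrix.mulVec, dotProduct, Finset.sum_apply, Pi.mul_apply]
  refine h1.congr_deriv ?_
  simp only [Matrix.mulVec, dotProduct, ← Finset.sum_add_distrib]

omit [DecidableEq n] in
/-- ★ **THE MIXED ROW BY DIFFERENTIATION.**  If the first-order response row `w τ + A τ *ᵥ m τ = 0` holds for all `τ` in a neighbourhood of
`τ₀`, and at `τ₀` the source has coordinatewise derivative `w′`, the Hessian entrywise derivative `A′`, and the first-order response coordinatewise
derivative `m′`, then `w′ + A′ *ᵥ m τ₀ + A τ₀ *ᵥ m′ = 0` — the mixed row consumed by `abs_mixedResponse_le` (`u := w′`, `P := A′`, `mₛ := m τ₀`,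
`mₛₜ := m′`). [cite: Balaban1985Variational, Thm 1 (10) p. 279] [cite: Rudin1976, Thm 5.3 (product rule)] -/
theorem mixed_row_of_hasDerivAt {w : ℝ → n → ℝ} {w' : n → ℝ} {A : ℝ → Matrix n n ℝ} {A' : Matrix n n ℝ}
    {m : ℝ → n → ℝ} {m' : n → ℝ} {τ₀ : ℝ}
    (hrow : ∀ᶠ τ in 𝓝 τ₀, w τ + A τ *ᵥ m τ = 0)
    (hw : ∀ k, HasDerivAt (fun τ => w τ k) (w' k) τ₀)
    (hA : ∀ k l, HasDerivAt (fun τ => A τ k l) (A' k l) τ₀) (hm : ∀ l, HasDerivAt (fun τ => m τ l) (m' l) τ₀) :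
    w' + A' *ᵥ m τ₀ + A τ₀ *ᵥ m' = 0 := by
  funext k
  -- the coordinate `k` of the row is identically zero near `τ₀`, hence has derivative zero
  have hsum : HasDerivAt (fun τ => w τ k + (A τ *ᵥ m τ) k) (w' k + ((A' *ᵥ m τ₀) k + (A τ₀ *ᵥ m') k)) τ₀ :=
    (hw k).add (hasDerivAt_mulVec_apply hA hm k)
  have hzero : (fun τ => w τ k + (A τ *ᵥ m τ) k) =ᶠ[𝓝 τ₀] fun _ => (0 : ℝ) :=
    hrow.mono fun τ hτ => by
      have := congrArg (fun f => f k) hτ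
      simpa only [Pi.add_apply, Pi.zero_apply] using this
  have hderiv0 : HasDerivAt (fun τ => w τ k + (A τ *ᵥ m τ) k) 0 τ₀ :=
    (hasDerivAt_const τ₀ (0 : ℝ)).congr_of_eventuallyEq hzero
  have huniq := hsum.unique hderiv0
  simpa only [Pi.add_apply, Pi.zero_apply, add_assoc] using huniq

end Literature.Analysis.Matrix

end
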